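import Mathlib
import Literature.MathematicalPhysics.QuantumFieldTheory.Balaban1983to89.B5DPD126Uniform
import Summits.QuantumFields.BalabanUV.T4Continuum.Support.SliceFlatGaugeKernel

/-!
# T⁴ programme, node NE3 — BRIDGE-126, part 2b: the remaining factor identifications (`Q′G′²Q′* ↔ qggqRe`,
# `(Q′G′²Q′*)⁻¹ ↔ kerRe`, `Q′G′ ↔ QGRe`, `Re ∂_n ↔ Dmat`), the BRIDGE `Re(∂·PcT·∂ᴴ) = Dmat·(KRe·kerRe·QGRe)·Dmatᵀ ∘ idxT`,
# and the n- and volume-UNIFORM decay of pv15's `∂P∂*` read off b05's (1.126)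

Fourteenth generation of the NE3 prover lineage P1 of the cell `pub-balaban`, file 4 (closes BRIDGE-126 = cell census
G-B5-35 (iii) for the gauge-fixing kernel).  Parts 1a∕1b∕2a gave, on pv15's carrier `Tor (fine n N)`:
`reM (∂_c·PcT·∂_cᴴ) = Re ∂_c · PGm a′ c · (Re ∂_c)ᵀ` (`PGm = Gm·Q′ᵀ·Cm·Q′·Gm`, concrete inverses) and
`(Gm (a·n^D) n · Q′*)(x,y) = KRe n a N (idxT x) (idxB y)` (b04's `K_T`).  THIS FILE:
 * §1 **`qggqRe_eq`**: `qggqRe n a N (idxB y) (idxB y′) = n^D · QGGQm (a·n^D) n y y′` (b05's `qggq = ξ^D Σ_z K̄_T K_T` summed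
   over the box = over `Idx` = over `Tor` along `idxT`; `Gm` symmetric); **`kerRe_eq`**: `kerRe (idxB y) (idxB y′) =
   n^{−D}·Cm (a·n^D) n y y′` (b05's `qggqRe_inv` + `Matrix.inv_reindex`); **`QGRe_eq`**: `QGRe (idxB y) (idxT x) = (Q′·Gm)(y,x)`;
   **`matrixP_eq_PGm`**: `(KRe·kerRe·QGRe)(idxT x, idxT x′) = PGm (a·n^D) n x x′`;
 * §2 **`Dmat_eq_reM_GradOp`**: b05's `Dmat n (n·N) μ (idxT x) (idxT x₁) = reM ∂_n ((x,μ), x₁)` (forward `η⁻¹`-difference;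
   `idxT (x + e_μ) = fup μ (idxT x)`);
 * §3 **THE BRIDGE** `reM_dPd_eq_matrixP`: for every `a > 0`,
   `reM (∂_n·PcT·∂_nᴴ) ((x,μ),(x′,ν)) = (Dmat μ·(KRe n a N·kerRe n a N·QGRe n a N)·Dmat νᵀ)(idxT x, idxT x′)`,
   and **`reM_dPd_decay_uniform`**: `∃ δ > 0, C ≥ 0` (from b05's `B5DPD126Uniform.matrixP_decay_uniform` at `a = 1`) such that for
   EVERY `n ≥ 1`, every period vector `N` and all entries,
   `|reM (∂_n·PcT_{n,N}·∂_nᴴ)((x,μ),(x′,ν))| ≤ n^{−D}·C·e^{−δ·|⌊x/n⌋ − ⌊x′/n⌋|_{T₁}}` — [B5] (1.126) «the constant O(1) depends on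
   d only» for the operator INSIDE pv15's `B5DeltaA169.DeltaA`, uniformly in the lattice spacing and the volume.
WHAT THIS BUYS (honest): the `J_P`-type input every consumer of pv15's `Δ_a = Δ − ∂P∂* + aQ*Q` needed (β-cell
`Beta.DeltaACombesThomas`, pv15 `B5Decay126`, this lineage's `SliceFlatMassTerm.gaugeDev`) is now a THEOREM about pv15's own
matrix; the NE3 packaging (`gaugeDev` in the (3.49) shape, level-free constants, and the full `hT349` at `U = 1`) is the next file.
Constants are b05's existential `δ, C` (functions of `d` only at `a = 1`); nothing printed is matched.  NE3 is NOT proved.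

Honest framing: finite-T⁴ ultraviolet bookkeeping about MINIMISERS (rung (B)+1 of the cell's ladder); no conditional of the
cell (`BetaPertH`, (B), (B^μ)) is used or hidden; nothing bears on infinite volume, a mass gap, or the Clay problem.  ABSOLUTE
RULE of the cell kept: inputs are kernel-proved tree modules only (b05 `B5DPD126Uniform`∕`B5QGGQ145Bounds`∕`Factor`, b04
`B4TorusPositivity`, pv15 `B5*`, this lineage's parts 1a∕1b∕2a); `[B5]` pointers locate text only.  No `sorry`, no axioms beyond
Mathlib's.  PLACEMENT (human rule 2026-08-19): cell work under `Summits/QuantumFields/BalabanUV/`; moves nothing.  Records: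
`t4/T4-EST-U1b-OSC.md` v1.29 (RESULT 37), `t4/T4-EST-NE3-P1.md` v2.28, GAPS G-ne3p1-43 of the cell `pub-balaban`.
-/

noncomputable section

open scoped Matrix ComplexConjugate
open Finset Matrix

namespace Summit.QuantumFields.BalabanUV.T4Continuum.SliceFlatGaugeBridge

open Literature.MathematicalPhysics.QuantumFieldTheory.Balaban1983to89
open Literature.MathematicalPhysics.QuantumFieldTheory.Balaban1983to89.B5Prop11Plancherel (Tor fine unitVec)
open Literature.MathematicalPhysics.QuantumFieldTheory.Balaban1983to89.B5Action121 (LapS GradOp sdiff shiftS sdiff_mulVec)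
open Literature.MathematicalPhysics.QuantumFieldTheory.Balaban1983to89.B5Block118 (QsOp)
open Literature.MathematicalPhysics.QuantumFieldTheory.Balaban1983to89.B5Value126 (PcT)
open Literature.MathematicalPhysics.QuantumFieldTheory.Balaban1983to89.B5RealFields
  (reM cplx IsReal cplx_apply isReal_GradOp)
open Literature.MathematicalPhysics.QuantumFieldTheory.Balaban1983to89.B4Green244 (coarse e)
open Literature.MathematicalPhysics.QuantumFieldTheory.Balaban1983to89.B4TorusGreen244 (KT)
open Literature.MathematicalPhysics.QuantumFieldTheory.Balaban1983to89.B4TorusPositivity (box)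
open Literature.MathematicalPhysics.QuantumFieldTheory.Balaban1983to89.B4TorusKernel.MultiPeriod (torusSupNorm)
open Literature.MathematicalPhysics.QuantumFieldTheory.Balaban1983to89.B5QGGQ145Torus (qggq)
open Literature.MathematicalPhysics.QuantumFieldTheory.Balaban1983to89.B5QGGQ145Bounds
  (Idx toZ qggqRe kerRe sum_box_eq_sum_idx qggqRe_inv)
open Literature.MathematicalPhysics.QuantumFieldTheory.Balaban1983to89.B5QGGQ145Factor (KRe QGRe KRe_coe)
open Literature.MathematicalPhysics.QuantumFieldTheory.Balaban1983to89.B5DPD126Uniform (Dmat fup matrixP_decay_uniform)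
open Summit.QuantumFields.BalabanUV.T4Continuum.SliceFlatGaugeProjection (conj_ofReal')
open Summit.QuantumFields.BalabanUV.T4Continuum.SliceFlatGaugeGreen
open Summit.QuantumFields.BalabanUV.T4Continuum.SliceFlatGaugeKernel

variable {d : ℕ} (n : ℕ) [NeZero n] (N : Fin (d + 1) → ℕ) [hN : ∀ i, NeZero (N i)]

/-! ## §1  `Q′G′²Q′* ↔ qggqRe`, `(·)⁻¹ ↔ kerRe`, `Q′G′ ↔ QGRe`, and the (1.44)-form projection `KRe·kerRe·QGRe = PGm` -/
section Factors

omit [NeZero n] in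
/-- `1 ≤ N_i`. [folklore] -/
theorem one_le_N : ∀ i, 1 ≤ N i := fun i => Nat.one_le_iff_ne_zero.mpr (NeZero.ne (N i))

/-- **`Q′G′²Q′* = qggqRe`, up to the factor `n^D` of the printed adjoint**: `qggqRe n a N (idxB y) (idxB y′) =
n^D · QGGQm (a·n^D) n y y′` (b05's `qggq = ξ^D Σ_{z∈T_ξ} K̄_T(z,y) K_T(z,y′)`, the sum over the box read over `Tor (fine n N)`,
`K_T` = the Green column by part 2a, `G′` symmetric). [folklore] -/
theorem qggqRe_eq {a : ℝ} (ha : 0 < a) (y y' : Tor N) :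
    qggqRe n a N (idxB N y) (idxB N y')
      = (n : ℝ) ^ (d + 1) * QGGQm n N (a * (n : ℝ) ^ (d + 1)) (n : ℝ) y y' := by
  have hn1 : 1 ≤ n := Nat.one_le_iff_ne_zero.mpr (NeZero.ne n)
  have hN1 := one_le_N N
  have hn : ((n : ℝ) ^ (d + 1)) ≠ 0 := pow_ne_zero _ (by exact_mod_cast NeZero.ne n)
  -- the complex sum over the box, as a real sum over the fine torus
  have hq : qggqRe n a N (idxB N y) (idxB N y')
      = ((n : ℝ) ^ (d + 1))⁻¹ * ∑ x : Tor (fine n N), KRe n a N (idxT n N x) (idxB N y) * KRe n a N (idxT n N x) (idxB N y') := by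
    rw [qggqRe, Matrix.of_apply, qggq, sum_box_eq_sum_idx, ← Equiv.sum_comp (idxT n N)]
    have hterm : ∀ x : Tor (fine n N),
        conj (KT n a 0 N (toZ (idxT n N x)) (toZ (idxB N y))) * KT n a 0 N (toZ (idxT n N x)) (toZ (idxB N y'))
          = (((KRe n a N (idxT n N x) (idxB N y) * KRe n a N (idxT n N x) (idxB N y') : ℝ)) : ℂ) := by
      intro x
      rw [← KRe_coe n hn1 a ha hN1, ← KRe_coe n hn1 a ha hN1, Complex.conj_ofReal, Complex.ofReal_mul]
    simp_rw [hterm]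
    rw [← Complex.ofReal_sum, show ((n : ℂ) ^ (d + 1))⁻¹ = (((((n : ℝ) ^ (d + 1))⁻¹ : ℝ)) : ℂ) by push_cast; rfl,
      ← Complex.ofReal_mul, Complex.ofReal_re]
  rw [hq]
  simp_rw [← Gm_QsW_eq_KRe n N ha]
  -- Σ_x (G Q*)(x,y) (G Q*)(x,y′) = ((G Q*)ᵀ (G Q*))(y,y′) = n^{2D} · QGGQm
  have hprod : ∑ x : Tor (fine n N), (Gm n N (a * (n : ℝ) ^ (d + 1)) (n : ℝ) * QsWm n N) x y
        * (Gm n N (a * (n : ℝ) ^ (d + 1)) (n : ℝ) * QsWm n N) x y'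
      = ((Gm n N (a * (n : ℝ) ^ (d + 1)) (n : ℝ) * QsWm n N)ᵀ * (Gm n N (a * (n : ℝ) ^ (d + 1)) (n : ℝ) * QsWm n N)) y y' := by
    simp only [Matrix.mul_apply, Matrix.transpose_apply]
  rw [hprod, QsWm, Matrix.mul_smul, transpose_smul, transpose_mul, Gm_transpose, Matrix.smul_mul, Matrix.mul_smul, smul_smul,
    Matrix.smul_apply, smul_eq_mul, QGGQm]
  have hassoc : (reM (QsOp n N))ᵀᵀ * Gm n N (a * (n : ℝ) ^ (d + 1)) (n : ℝ)
        * (Gm n N (a * (n : ℝ) ^ (d + 1)) (n : ℝ) * (reM (QsOp n N))ᵀ)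
      = reM (QsOp n N) * Gm n N (a * (n : ℝ) ^ (d + 1)) (n : ℝ) * Gm n N (a * (n : ℝ) ^ (d + 1)) (n : ℝ) * (reM (QsOp n N))ᵀ := by
    rw [transpose_transpose]; simp only [Matrix.mul_assoc]
  rw [hassoc]
  field_simp

/-- `qggqRe` IS the reindexed `n^D·QGGQm`. [folklore] -/
theorem qggqRe_eq_reindex {a : ℝ} (ha : 0 < a) :
    qggqRe n a N = Matrix.reindex (idxB N) (idxB N) (((n : ℝ) ^ (d + 1)) • QGGQm n N (a * (n : ℝ) ^ (d + 1)) (n : ℝ)) := by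
  ext k k'
  rw [Matrix.reindex_apply, Matrix.submatrix_apply, Matrix.smul_apply, smul_eq_mul,
    ← qggqRe_eq n N ha ((idxB N).symm k) ((idxB N).symm k'), Equiv.apply_symm_apply, Equiv.apply_symm_apply]

/-- **`(Q′G′²Q′*)⁻¹ = kerRe`**: `kerRe n a N (idxB y) (idxB y′) = n^{−D}·Cm (a·n^D) n y y′` (b05's `qggqRe_inv`, the inverse of a
reindexed scaled matrix). [folklore] -/
theorem kerRe_eq {a : ℝ} (ha : 0 < a) (y y' : Tor N) :
    kerRe n a N (idxB N y) (idxB N y')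
      = ((n : ℝ) ^ (d + 1))⁻¹ * Cm n N (a * (n : ℝ) ^ (d + 1)) (n : ℝ) y y' := by
  have hn0 : (n : ℝ) ≠ 0 := by exact_mod_cast NeZero.ne n
  have hn : ((n : ℝ) ^ (d + 1)) ≠ 0 := pow_ne_zero _ hn0
  have haK : 0 < a * (n : ℝ) ^ (d + 1) := mul_pos ha (by positivity)
  have hinv : (((n : ℝ) ^ (d + 1)) • QGGQm n N (a * (n : ℝ) ^ (d + 1)) (n : ℝ))⁻¹
      = ((n : ℝ) ^ (d + 1))⁻¹ • Cm n N (a * (n : ℝ) ^ (d + 1)) (n : ℝ) := by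
    apply Matrix.inv_eq_left_inv
    rw [Matrix.smul_mul, Matrix.mul_smul, smul_smul, inv_mul_cancel₀ hn, one_smul, Cm_mul_QGGQm n N hn0 haK]
  rw [← qggqRe_inv n (Nat.one_le_iff_ne_zero.mpr (NeZero.ne n)) a ha (one_le_N N), qggqRe_eq_reindex n N ha, Matrix.inv_reindex, hinv, Matrix.reindex_apply,
    Matrix.submatrix_apply, Equiv.symm_apply_apply, Equiv.symm_apply_apply, Matrix.smul_apply, smul_eq_mul]

/-- **`Q′G′ = QGRe`**: `QGRe n a N (idxB y) (idxT x) = (Q′·Gm (a·n^D) n)(y, x)` (`QGRe = ξ^D·KReᵀ`, `G′` symmetric). [folklore] -/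
theorem QGRe_eq {a : ℝ} (ha : 0 < a) (y : Tor N) (x : Tor (fine n N)) :
    QGRe n a N (idxB N y) (idxT n N x) = (reM (QsOp n N) * Gm n N (a * (n : ℝ) ^ (d + 1)) (n : ℝ)) y x := by
  have hn : ((n : ℝ) ^ (d + 1)) ≠ 0 := pow_ne_zero _ (by exact_mod_cast NeZero.ne n)
  rw [QGRe, Matrix.smul_apply, Matrix.transpose_apply, ← Gm_QsW_eq_KRe n N ha, QsWm, Matrix.mul_smul, Matrix.smul_apply,
    smul_eq_mul, smul_eq_mul, ← mul_assoc, inv_mul_cancel₀ hn, one_mul, ← Matrix.transpose_apply (reM (QsOp n N) * _) x y,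
    transpose_mul, Gm_transpose]

/-- **THE (1.44)-FORM PROJECTION OF BOTH CHAINS IS ONE OBJECT**: `(KRe·kerRe·QGRe)(idxT x, idxT x′) = PGm (a·n^D) n x x′`. [folklore] -/
theorem matrixP_eq_PGm {a : ℝ} (ha : 0 < a) (x x' : Tor (fine n N)) :
    (KRe n a N * kerRe n a N * QGRe n a N) (idxT n N x) (idxT n N x')
      = PGm n N (a * (n : ℝ) ^ (d + 1)) (n : ℝ) x x' := by
  have hn : ((n : ℝ) ^ (d + 1)) ≠ 0 := pow_ne_zero _ (by exact_mod_cast NeZero.ne n)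
  -- the b05 side, entry by entry, through the three identified factors (sums over `Idx N` read over `Tor N`)
  have hL : (KRe n a N * kerRe n a N * QGRe n a N) (idxT n N x) (idxT n N x')
      = ∑ y' : Tor N, (∑ y : Tor N, (Gm n N (a * (n : ℝ) ^ (d + 1)) (n : ℝ) * QsWm n N) x y
          * (((n : ℝ) ^ (d + 1))⁻¹ * Cm n N (a * (n : ℝ) ^ (d + 1)) (n : ℝ) y y'))
          * (reM (QsOp n N) * Gm n N (a * (n : ℝ) ^ (d + 1)) (n : ℝ)) y' x' := by
    rw [Matrix.mul_apply, ← Equiv.sum_comp (idxB N)]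
    refine Finset.sum_congr rfl fun y' _ => ?_
    rw [Matrix.mul_apply, ← Equiv.sum_comp (idxB N), QGRe_eq n N ha]
    refine congrArg₂ (· * ·) (Finset.sum_congr rfl fun y _ => ?_) rfl
    rw [Gm_QsW_eq_KRe n N ha, kerRe_eq n N ha]
  -- the pv15 side as the same triple product
  have hR : PGm n N (a * (n : ℝ) ^ (d + 1)) (n : ℝ)
      = (Gm n N (a * (n : ℝ) ^ (d + 1)) (n : ℝ) * (reM (QsOp n N))ᵀ) * Cm n N (a * (n : ℝ) ^ (d + 1)) (n : ℝ)
          * (reM (QsOp n N) * Gm n N (a * (n : ℝ) ^ (d + 1)) (n : ℝ)) := by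
    rw [PGm]; simp only [Matrix.mul_assoc]
  rw [hL, hR, Matrix.mul_apply]
  refine Finset.sum_congr rfl fun y' _ => ?_
  refine congrArg₂ (· * ·) ?_ rfl
  rw [Matrix.mul_apply]
  refine Finset.sum_congr rfl fun y _ => ?_
  rw [QsWm, Matrix.mul_smul, Matrix.smul_apply, smul_eq_mul]
  field_simp

end Factors

/-! ## §2  `Re ∂_n ↔ Dmat` -/
section Gradient

/-- `idxT (x + e_μ) = fup μ (idxT x)`: pv15's unit step is b05's torus neighbour. [folklore] -/
theorem idxT_add_unitVec (x : Tor (fine n N)) (μ : Fin (d + 1)) :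
    idxT n N (x + unitVec (fine n N) μ) = fup μ (idxT n N x) := by
  funext i
  apply Fin.ext
  by_cases h : i = μ
  · subst h
    show ((x i + (Pi.single i (1 : ZMod (fine n N i)) : Tor (fine n N)) i).val) = _
    rw [fup, Function.update_self, Pi.single_eq_same, ZMod.val_add, ZMod.val_one_eq_one_mod]
    show (ZMod.val (x i) + 1 % (n * N i)) % (n * N i) = (ZMod.val (x i) + 1) % (n * N i)
    rw [Nat.add_mod_mod]
  · show ((x i + (Pi.single μ (1 : ZMod (fine n N μ)) : Tor (fine n N)) i).val) = _
    rw [fup, Function.update_of_ne h, Pi.single_eq_of_ne h, add_zero]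
    rfl

/-- Entries of pv15's gradient block: `Re ∂_n((x,μ), x₁) = n·(𝟙[x₁ = x + e_μ] − 𝟙[x₁ = x])`. [folklore] -/
theorem reM_GradOp_apply (μ : Fin (d + 1)) (x x₁ : Tor (fine n N)) :
    reM (GradOp (fine n N) (n : ℂ)) (x, μ) x₁
      = (n : ℝ) * ((if x₁ = x + unitVec (fine n N) μ then 1 else 0) - (if x₁ = x then 1 else 0)) := by
  show (GradOp (fine n N) (n : ℂ) (x, μ) x₁).re = _
  have hcol : GradOp (fine n N) (n : ℂ) (x, μ) x₁
      = (GradOp (fine n N) (n : ℂ) *ᵥ (Pi.single x₁ (1 : ℂ))) (x, μ) := by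
    rw [Matrix.mulVec_single_one]; rfl
  rw [hcol, B5Action121.GradOp_mulVec, sdiff_mulVec]
  have h1 : (x₁ = x + unitVec (fine n N) μ) ↔ (x + unitVec (fine n N) μ = x₁) := eq_comm
  have h2 : (x₁ = x) ↔ (x = x₁) := eq_comm
  simp only [Pi.single_apply, h1, h2]
  split_ifs <;> simp

/-- **`Dmat = Re ∂_n`**: b05's forward `η⁻¹`-difference matrix on `Idx (n·N)` IS pv15's gradient block `Re ∂_n(·,μ)` on the
fine torus (lattice parameter `c = n = η⁻¹`). [folklore] -/
theorem Dmat_eq_reM_GradOp (μ : Fin (d + 1)) (x x₁ : Tor (fine n N)) :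
    Dmat n (fun i => n * N i) μ (idxT n N x) (idxT n N x₁) = reM (GradOp (fine n N) (n : ℂ)) (x, μ) x₁ := by
  rw [Dmat, Matrix.of_apply, ← idxT_add_unitVec, reM_GradOp_apply]
  have e1 : ((idxT n N) x₁ = (idxT n N) (x + unitVec (fine n N) μ)) ↔ (x₁ = x + unitVec (fine n N) μ) :=
    (idxT n N).apply_eq_iff_eq
  have e2 : ((idxT n N) x₁ = (idxT n N) x) ↔ (x₁ = x) := (idxT n N).apply_eq_iff_eq
  by_cases h1 : x₁ = x + unitVec (fine n N) μ
  · rw [if_pos (e1.mpr h1), if_pos h1]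
    by_cases h2 : x₁ = x
    · rw [if_pos (e2.mpr h2), if_pos h2]
    · rw [if_neg (fun h => h2 (e2.mp h)), if_neg h2]
  · rw [if_neg (fun h => h1 (e1.mp h)), if_neg h1]
    by_cases h2 : x₁ = x
    · rw [if_pos (e2.mpr h2), if_pos h2]
    · rw [if_neg (fun h => h2 (e2.mp h)), if_neg h2]

end Gradient

/-! ## §3  THE BRIDGE and the uniform decay of pv15's `∂P∂*` -/
section Bridge

/-- **BRIDGE-126.**  For every `a > 0`, all directions `μ, ν` and fine sites `x, x′`:
`reM (∂_n · PcT_{n,N} · ∂_nᴴ) ((x,μ),(x′,ν)) = (Dmat μ · (KRe n a N · kerRe n a N · QGRe n a N) · Dmat νᵀ)(idxT x, idxT x′)` — the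
gauge-fixing operator `∂P∂*` of [B5] (1.69)–(1.70) inside pv15's `B5DeltaA169.DeltaA n N a` IS, entry by entry, b05's
counting-measure matrix of `∂_μ P ∂_ν^*` with `P` in the (1.44) form (`B5DPD126Uniform.Dmat_matrixP_Dmat_transpose`). [folklore] -/
theorem reM_dPd_eq_matrixP {a : ℝ} (ha : 0 < a) (μ ν : Fin (d + 1)) (x x' : Tor (fine n N)) :
    reM (GradOp (fine n N) (n : ℂ) * PcT n N (n : ℂ) * (GradOp (fine n N) (n : ℂ))ᴴ) (x, μ) (x', ν)
      = (Dmat n (fun i => n * N i) μ * (KRe n a N * kerRe n a N * QGRe n a N)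
          * (Dmat n (fun i => n * N i) ν)ᵀ) (idxT n N x) (idxT n N x') := by
  have hn0 : (n : ℝ) ≠ 0 := by exact_mod_cast NeZero.ne n
  have haK : 0 < a * (n : ℝ) ^ (d + 1) := mul_pos ha (by positivity)
  have h1 := reM_GradOp_PcT_GradOp n N hn0 haK
  rw [Complex.ofReal_natCast] at h1
  rw [h1, Matrix.mul_apply, Matrix.mul_apply, ← Equiv.sum_comp (idxT n N)]
  refine Finset.sum_congr rfl fun x₂ _ => ?_
  rw [Matrix.transpose_apply, Matrix.transpose_apply, Dmat_eq_reM_GradOp, Matrix.mul_apply, Matrix.mul_apply,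
    ← Equiv.sum_comp (idxT n N)]
  refine congrArg₂ (· * ·) (Finset.sum_congr rfl fun x₁ _ => ?_) rfl
  rw [Dmat_eq_reM_GradOp, matrixP_eq_PGm n N ha]

/-- **(1.126) FOR pv15's `∂P∂*`, UNIFORMLY IN THE LATTICE SPACING AND THE VOLUME.**  There are `δ > 0`, `C ≥ 0` — b05's constants
of `B5DPD126Uniform.matrixP_decay_uniform` at `a = 1`, functions of `d` only — such that for EVERY `n ≥ 1` (`NeZero n`), every
period vector `N` (`NeZero (N i)`), all `μ ν x x′`:
`|reM (∂_n·PcT_{n,N}·∂_nᴴ)((x,μ),(x′,ν))| ≤ n^{−D} · C · exp(−δ·|⌊x/n⌋ − ⌊x′/n⌋|_{T₁})` with `⌊x/n⌋ = (val x_i / n)_i` the block of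
`x` and `|·|_{T₁}` the sup torus distance of the unit torus — [B5] p. 38 «The constant O(1) in (1.126) depends on d only», for the
operator INSIDE `B5DeltaA169.DeltaA`. [folklore] -/
theorem reM_dPd_decay_uniform (d : ℕ) :
    ∃ δ C : ℝ, 0 < δ ∧ 0 ≤ C ∧ ∀ (n : ℕ) [NeZero n] (N : Fin (d + 1) → ℕ) [∀ i, NeZero (N i)]
      (μ ν : Fin (d + 1)) (x x' : Tor (fine n N)),
      |reM (GradOp (fine n N) (n : ℂ) * PcT n N (n : ℂ) * (GradOp (fine n N) (n : ℂ))ᴴ) (x, μ) (x', ν)|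
        ≤ ((n : ℝ) ^ (d + 1))⁻¹ * C
          * Real.exp (-(δ * torusSupNorm N (coarse n (repT n N x) - coarse n (repT n N x')))) := by
  obtain ⟨δ, C, hδ, hC, h⟩ := matrixP_decay_uniform d 1 1 one_pos
  refine ⟨δ, C, hδ, hC, fun n _ N _ μ ν x x' => ?_⟩
  rw [reM_dPd_eq_matrixP n N one_pos, ← toZ_idxT, ← toZ_idxT]
  exact h n 1 le_rfl le_rfl N (one_le_N N) μ ν (idxT n N x) (idxT n N x')

end Bridge

end Summit.QuantumFields.BalabanUV.T4Continuum.SliceFlatGaugeBridge
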